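import Summits.Ventures.WeilGRH.TwistedGramCellCheckCK
import HarnessLib

/-!
# GRH arm: twisted format C for COMPLEX characters — checker `K` at TAIL ORDER `J = 2`, part 1/2: the `J = 2` TAIL BOX (`uC2`) and its soundness

Cell `rh-explicit`, WEIL TRACK — GRH ARM (engine seat weil-grh-2 gen15).  `TwistedGramCellCheckCK` instantiates the data door
`weilPositivityOnChar_of_twistedC_formatC_dataJ` at `J = 1`; this file instantiates it at `J = 2` with tail weights `λ = (1, r)`, `r = rN/rD`:
the diagonal tail term falls from `(2B−1)(4A′κ/π)²/(3d₀(B₃−1)³)` to `(2B−1)(4A′κ²/π)²/(5d₀(B₃−1)⁵)` at the price of the bracket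
`K₁₁ κ_i κ_{i′}` (signed modes) in the two rank-one parts (`K₀₀ = 1/(B₃−1) + r(1/(4(B₃−1)²) − 1/(4B₃²))`, `K₁₁ = 1/(3(B₃−1)³) + (1/(4(B₃−1)²) − 1/(4B₃²))/r`;
the `j ≠ j′` brackets cancel between the two copies of the tail).  Float sizing (weil-grh-2 gen15, sizeJ2.py): the last even complex primitive
class of conductor ≤ 20 without a `t = 1` cell, 7.2/7.4, has block margin 2.4e−4 and is NOT PD with the `J = 1` tail on the A1 table
(−1.3e−4 at (40,160)) but IS with `J = 2` (+1.6e−4, `r = 8`, `θ = 0.03`, `η = 1/2`).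
Contents of part 1 (this file): `K2TailData`, `kBox00` / `kBox11` / `gBox`, `uC2` / `uC2Real` / `mem_uC2` (the `J = 2` tail box and its soundness);
part 2 (`TwistedGramCellCheckCK2`): `cellK2`, `checkCellK2Block` (+ `_iff`, glue), `mem_cellK2`, `psd_of_checkCellK2`, `weilPositivityOnChar_of_checkCellK2`.
(Split in two files ≤ 400 lines by weil-grh-1 gen12 when filing weil-grh-2 gen15's staged 435-line source; content unchanged.)  Everything proved; computable `def`s; RH/GRH-free.  References: H. Yoshida (1992) §§5–7 [Yoshida1992HermitianForms];
R. E. Moore (1966) Ch. 3 [Moore1966]; von zur Gathen–Gerhard (2013) §8.4 [vzGG2013].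
-/

set_option autoImplicit false
set_option linter.style.longLine false

open Real Complex Finset
open scoped BigOperators ArithmeticFunction.vonMangoldt ComplexConjugate

namespace Summit.Ventures.WeilGRH

open Literature.NumberTheory.LFunctions Literature.NumberTheory.LFunctions.Yoshida1992
open Literature.NumberTheory.LFunctions.Yoshida1992.Encl
open Literature.Analysis.SpecialFunctions Literature.Analysis.ValidatedNumerics.NumericsMP
open Kron

namespace TwistedEncl

/-! ## The `J = 2` tail -/

/-- Tail weights `λ = (1, r)`, `r = rN/rD`. -/
structure K2TailData where
  /-- numerator of `r` -/
  rN : ℕ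
  /-- denominator of `r` -/
  rD : ℕ
  deriving Repr, Inhabited

/-- `K₀₀ = 1/(B₃−1) + r·(1/(4(B₃−1)²) − 1/(4B₃²))`, boxed. [cite: Yoshida1992HermitianForms, §7 pp. 305–312] -/
def kBox00 (S B3 : ℕ) (f : K2TailData) : MI :=
  ((MI.ofInt S 1).divNat (B3 - 1)).add
    (((((MI.ofInt S 1).divNat (4 * (B3 - 1) ^ 2)).sub ((MI.ofInt S 1).divNat (4 * B3 ^ 2))).mulInt (f.rN : ℤ)).divNat f.rD)

/-- `K₁₁ = 1/(3(B₃−1)³) + (1/(4(B₃−1)²) − 1/(4B₃²))/r`, boxed. [cite: Yoshida1992HermitianForms, §7 pp. 305–312] -/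
def kBox11 (S B3 : ℕ) (f : K2TailData) : MI :=
  ((MI.ofInt S 1).divNat (3 * (B3 - 1) ^ 3)).add
    (((((MI.ofInt S 1).divNat (4 * (B3 - 1) ^ 2)).sub ((MI.ofInt S 1).divNat (4 * B3 ^ 2))).mulInt (f.rD : ℤ)).divNat f.rN)

/-- `g(i,i′) = 2(K₀₀ + K₁₁ κ_i κ_{i′})` (SIGNED modes), boxed. [cite: Yoshida1992HermitianForms, §7 pp. 305–312] -/
def gBox (S B3 : ℕ) (f : K2TailData) (kk : ℤ) : MI :=
  ((kBox00 S B3 f).add ((kBox11 S B3 f).mulInt kk)).mulInt 2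

/-- The order-2 two-sided tail `U₂(i,i′)` of the door, boxed:
`(1+θ)(1+η)A²/(π²d₀)·s s′ g + (1+θ)(1+η⁻¹)/d₀·s s′ g F̃_i F̃_{i′} + δ_{ii′}·2(1+θ⁻¹)(2B−1)/(5d₀(B₃−1)⁵)(4A′κ_i²/π)²`.
[cite: Yoshida1992HermitianForms, §7 pp. 305–312] -/
def uC2 (S : ℕ) (C : Consts) (xs ys : List MI) (tab : List IdxRec) (d : CCellData) (e : CTailData) (f : K2TailData)
    (i i' : ℕ) : MI :=
  let Sig := sigBox S C
  let cpi := d.CC.mul S C.invPi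
  let A := ((C.P.divNat 4).add Sig).add (cpi.divNat d.B3)
  let A' := ((C.P.divNat 4).add Sig).add cpi
  let s : ℤ := sgnOfIdx i * sgnOfIdx i'
  let k : ℕ := (modeOfIdx i).natAbs
  let G := gBox S d.B3 f (modeOfIdx i * modeOfIdx i')
  let t1 := ((((((((A.mul S A).mul S C.invPi).mul S C.invPi).mulInt ((e.θD : ℤ) + e.θN)).divNat e.θD).mulInt
    ((e.ηD : ℤ) + e.ηN)).divNat e.ηD).mul S G)
  let t1 := (t1.mulInt (s * 2 ^ d.wbits)).divNat d.d0N
  let F := (fTilBox S C xs ys tab i).mul S (fTilBox S C xs ys tab i')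
  let t2 := (((((F.mulInt ((e.θD : ℤ) + e.θN)).divNat e.θD).mulInt ((e.ηN : ℤ) + e.ηD)).divNat e.ηN).mul S G)
  let t2 := (t2.mulInt (s * 2 ^ d.wbits)).divNat d.d0N
  let Gd := (A'.mul S C.invPi).mulInt ((4 * k ^ 2 : ℕ) : ℤ)
  let t3 := ((((Gd.mul S Gd).mulInt ((e.θN : ℤ) + e.θD)).divNat e.θN).mulInt (((2 * d.B - 1 : ℕ) : ℤ) * 2 * 2 ^ d.wbits)).divNat
    (5 * d.d0N * (d.B3 - 1) ^ 5)
  (t1.add t2).add (if i = i' then t3 else MI.ofInt S 0)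

/-- The real `J = 2` tail `U₂(i,i′)` (module docstring), `F` = the function `i ↦ F̃_i`, `r` the weight ratio. [cite: Yoshida1992HermitianForms, §7 pp. 305–312] -/
noncomputable def uC2Real (Sig Cc θ η d0 r : ℝ) (B B3 : ℕ) (F : ℕ → ℝ) (i i' : ℕ) : ℝ :=
  let A := Real.pi / 4 + Sig + Cc / Real.pi / B3
  let A' := Real.pi / 4 + Sig + Cc / Real.pi
  let K00 := 1 / ((B3 - 1 : ℕ) : ℝ) + r * (1 / (4 * ((B3 - 1 : ℕ) : ℝ) ^ 2) - 1 / (4 * (B3 : ℝ) ^ 2))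
  let K11 := 1 / (3 * ((B3 - 1 : ℕ) : ℝ) ^ 3) + (1 / (4 * ((B3 - 1 : ℕ) : ℝ) ^ 2) - 1 / (4 * (B3 : ℝ) ^ 2)) / r
  let g := 2 * (K00 + K11 * ((modeOfIdx i * modeOfIdx i' : ℤ) : ℝ))
  let s := ((sgnOfIdx i : ℤ) : ℝ) * ((sgnOfIdx i' : ℤ) : ℝ)
  (1 + θ) * (1 + η) * A ^ 2 / Real.pi ^ 2 / d0 * s * g + (1 + θ) * (1 + η⁻¹) / d0 * s * g * (F i * F i') +
    (if i = i' then (1 + θ⁻¹) * (((2 * B - 1 : ℕ) : ℝ) * 2 / (5 * d0 * ((B3 - 1 : ℕ) : ℝ) ^ 5)) *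
      (A' / Real.pi * (((4 * (modeOfIdx i).natAbs ^ 2 : ℕ) : ℤ) : ℝ)) ^ 2 else 0)

variable {S : ℕ} {a : ℝ} {q : ℕ}

/-- `K₀₀ ∈ kBox00`. [cite: Moore1966, Ch. 3 (interval arithmetic: inclusion property)] -/
theorem mem_kBox00 {B3 : ℕ} (hB3 : 2 ≤ B3) {f : K2TailData} (hrD : 0 < f.rD) :
    MI.mem S (1 / ((B3 - 1 : ℕ) : ℝ) + ((f.rN : ℝ) / f.rD) * (1 / (4 * ((B3 - 1 : ℕ) : ℝ) ^ 2) - 1 / (4 * (B3 : ℝ) ^ 2)))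
      (kBox00 S B3 f) := by
  have h1 : MI.mem S ((1 : ℤ) : ℝ) (MI.ofInt S 1) := MI.mem_ofInt S 1
  have hB31 : 0 < B3 - 1 := by omega
  have hB30 : 0 < B3 := by omega
  unfold kBox00
  refine mem_of_eq (MI.mem_add (MI.mem_divNat h1 hB31) (MI.mem_divNat (MI.mem_mulInt (MI.mem_sub
    (MI.mem_divNat h1 (n := 4 * (B3 - 1) ^ 2) (by positivity)) (MI.mem_divNat h1 (n := 4 * B3 ^ 2) (by positivity))) (f.rN : ℤ)) hrD)) ?_
  have : (f.rD : ℝ) ≠ 0 := by exact_mod_cast hrD.ne'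
  push_cast
  field_simp

/-- `K₁₁ ∈ kBox11`. [cite: Moore1966, Ch. 3 (interval arithmetic: inclusion property)] -/
theorem mem_kBox11 {B3 : ℕ} (hB3 : 2 ≤ B3) {f : K2TailData} (hrN : 0 < f.rN) (hrD : 0 < f.rD) :
    MI.mem S (1 / (3 * ((B3 - 1 : ℕ) : ℝ) ^ 3) + (1 / (4 * ((B3 - 1 : ℕ) : ℝ) ^ 2) - 1 / (4 * (B3 : ℝ) ^ 2)) / ((f.rN : ℝ) / f.rD))
      (kBox11 S B3 f) := by
  have h1 : MI.mem S ((1 : ℤ) : ℝ) (MI.ofInt S 1) := MI.mem_ofInt S 1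
  have hB31 : 0 < B3 - 1 := by omega
  unfold kBox11
  refine mem_of_eq (MI.mem_add (MI.mem_divNat h1 (n := 3 * (B3 - 1) ^ 3) (by positivity)) (MI.mem_divNat (MI.mem_mulInt (MI.mem_sub
    (MI.mem_divNat h1 (n := 4 * (B3 - 1) ^ 2) (by positivity)) (MI.mem_divNat h1 (n := 4 * B3 ^ 2) (by positivity))) (f.rD : ℤ)) hrN)) ?_
  have : (f.rD : ℝ) ≠ 0 := by exact_mod_cast hrD.ne'
  have : (f.rN : ℝ) ≠ 0 := by exact_mod_cast hrN.ne'
  push_cast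
  field_simp

/-- Soundness of `uC2`. [cite: Moore1966, Ch. 3 (interval arithmetic: inclusion property)] -/
theorem mem_uC2 (hS : 0 < S) {ks : List PrimeLen} (hks : PrimeData a ks) {C : Consts} (hC : ConstsValid S a ks C)
    (χ : DirichletCharacter ℂ q) {xs ys : List MI}
    (hx : ∀ i < ks.length, MI.mem S (χ (((ks.getD i default).val : ℕ) : ZMod q)).re (xs.getD i default))
    (hy : ∀ i < ks.length, MI.mem S (χ (((ks.getD i default).val : ℕ) : ZMod q)).im (ys.getD i default))
    {N : ℕ} {tab : List IdxRec} (hT : TabValid S a ks N tab) {d : CCellData} {e : CTailData} {f : K2TailData}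
    (hθN : 0 < e.θN) (hθD : 0 < e.θD) (hηN : 0 < e.ηN) (hηD : 0 < e.ηD) (hd0 : 0 < d.d0N) (hB3 : 2 ≤ d.B3)
    (hrN : 0 < f.rN) (hrD : 0 < f.rD)
    {Cc : ℝ} (hCC : MI.mem S Cc d.CC) {i i' : ℕ} (hi : i < 2 * N - 1) (hi' : i' < 2 * N - 1) :
    MI.mem S (uC2Real (∑ k ∈ weilPrimeIndex a, (ArithmeticFunction.vonMangoldt k : ℝ) / Real.sqrt k) Cc
        ((e.θN : ℝ) / e.θD) ((e.ηN : ℝ) / e.ηD) ((d.d0N : ℝ) / 2 ^ d.wbits) ((f.rN : ℝ) / f.rD) d.B d.B3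
        (fun i ↦ ((Complex.digamma (1 / 4 + ((freq a (modeOfIdx i) : ℝ) : ℂ) / 2 * Complex.I)).im / 2
          + (∑ k ∈ weilPrimeIndex a, (ArithmeticFunction.vonMangoldt k : ℝ) / Real.sqrt k *
              ((χ (k : ZMod q)).re * Real.sin (freq a (modeOfIdx i) * Real.log k) +
                (χ (k : ZMod q)).im * Real.cos (freq a (modeOfIdx i) * Real.log k)))
          - archExpSumSin a (modeOfIdx i)) / Real.pi) i i')
      (uC2 S C xs ys tab d e f i i') := by
  set Sig := ∑ k ∈ weilPrimeIndex a, (ArithmeticFunction.vonMangoldt k : ℝ) / Real.sqrt k with hSigdef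
  have hSig : MI.mem S Sig (sigBox S C) := mem_sigBox hks hC
  have hπ := hC.invPi
  have hP := hC.pi
  have hB31 : 0 < d.B3 - 1 := by omega
  have hB30 : 0 < d.B3 := by omega
  have hcpi : MI.mem S (Cc / Real.pi) (d.CC.mul S C.invPi) := mem_of_eq (MI.mem_mul hS hCC hπ) (by ring)
  have hA : MI.mem S (Real.pi / 4 + Sig + Cc / Real.pi / d.B3)
      (((C.P.divNat 4).add (sigBox S C)).add ((d.CC.mul S C.invPi).divNat d.B3)) :=
    mem_of_eq (MI.mem_add (MI.mem_add (MI.mem_divNat hP (n := 4) (by norm_num)) hSig) (MI.mem_divNat hcpi hB30))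
      (by push_cast; ring)
  have hA' : MI.mem S (Real.pi / 4 + Sig + Cc / Real.pi) (((C.P.divNat 4).add (sigBox S C)).add (d.CC.mul S C.invPi)) :=
    mem_of_eq (MI.mem_add (MI.mem_add (MI.mem_divNat hP (n := 4) (by norm_num)) hSig) hcpi) (by push_cast; ring)
  have hF := mem_fTilBox hS hks hC χ hx hy hT hi
  have hF' := mem_fTilBox hS hks hC χ hx hy hT hi'
  have hG : MI.mem S (2 * ((1 / ((d.B3 - 1 : ℕ) : ℝ) + ((f.rN : ℝ) / f.rD) * (1 / (4 * ((d.B3 - 1 : ℕ) : ℝ) ^ 2) - 1 / (4 * (d.B3 : ℝ) ^ 2)))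
      + (1 / (3 * ((d.B3 - 1 : ℕ) : ℝ) ^ 3) + (1 / (4 * ((d.B3 - 1 : ℕ) : ℝ) ^ 2) - 1 / (4 * (d.B3 : ℝ) ^ 2)) / ((f.rN : ℝ) / f.rD))
        * ((modeOfIdx i * modeOfIdx i' : ℤ) : ℝ)))
      (gBox S d.B3 f (modeOfIdx i * modeOfIdx i')) := by
    unfold gBox
    exact mem_of_eq (MI.mem_mulInt (MI.mem_add (mem_kBox00 hB3 hrD) (MI.mem_mulInt (mem_kBox11 hB3 hrN hrD) _)) 2)
      (by push_cast; ring)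
  have hθD' : (e.θD : ℝ) ≠ 0 := by exact_mod_cast hθD.ne'
  have hθN' : (e.θN : ℝ) ≠ 0 := by exact_mod_cast hθN.ne'
  have hηD' : (e.ηD : ℝ) ≠ 0 := by exact_mod_cast hηD.ne'
  have hηN' : (e.ηN : ℝ) ≠ 0 := by exact_mod_cast hηN.ne'
  have hd0' : (d.d0N : ℝ) ≠ 0 := by exact_mod_cast hd0.ne'
  have hB3r : ((d.B3 - 1 : ℕ) : ℝ) ≠ 0 := by exact_mod_cast hB31.ne'
  have hB3r' : (d.B3 : ℝ) ≠ 0 := by exact_mod_cast hB30.ne'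
  have hrN' : (f.rN : ℝ) ≠ 0 := by exact_mod_cast hrN.ne'
  have hrD' : (f.rD : ℝ) ≠ 0 := by exact_mod_cast hrD.ne'
  have hπ0 : (Real.pi : ℝ) ≠ 0 := Real.pi_ne_zero
  -- term 1
  have h1 := MI.mem_divNat (MI.mem_mulInt (MI.mem_mul hS (MI.mem_divNat (MI.mem_mulInt (MI.mem_divNat (MI.mem_mulInt
    (MI.mem_mul hS (MI.mem_mul hS (MI.mem_mul hS hA hA) hπ) hπ) ((e.θD : ℤ) + e.θN)) hθD) ((e.ηD : ℤ) + e.ηN)) hηD) hG)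
    (sgnOfIdx i * sgnOfIdx i' * 2 ^ d.wbits)) (n := d.d0N) hd0
  -- term 2
  have h2 := MI.mem_divNat (MI.mem_mulInt (MI.mem_mul hS (MI.mem_divNat (MI.mem_mulInt (MI.mem_divNat (MI.mem_mulInt
    (MI.mem_mul hS hF hF') ((e.θD : ℤ) + e.θN)) hθD) ((e.ηN : ℤ) + e.ηD)) hηN) hG)
    (sgnOfIdx i * sgnOfIdx i' * 2 ^ d.wbits)) (n := d.d0N) hd0
  -- term 3
  have hGd := MI.mem_mulInt (MI.mem_mul hS hA' hπ) ((4 * (modeOfIdx i).natAbs ^ 2 : ℕ) : ℤ)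
  have h3 := MI.mem_divNat (MI.mem_mulInt (MI.mem_divNat (MI.mem_mulInt (MI.mem_mul hS hGd hGd) ((e.θN : ℤ) + e.θD)) hθN)
    (((2 * d.B - 1 : ℕ) : ℤ) * 2 * 2 ^ d.wbits)) (n := 5 * d.d0N * (d.B3 - 1) ^ 5)
    (Nat.mul_pos (Nat.mul_pos (by norm_num) hd0) (pow_pos hB31 5))
  unfold uC2
  simp only []
  by_cases hii : i = i'
  · rw [if_pos hii]
    refine mem_of_eq (MI.mem_add (MI.mem_add h1 h2) h3) ?_
    unfold uC2Real
    simp only [if_pos hii]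
    push_cast
    field_simp
  · rw [if_neg hii]
    refine mem_of_eq (MI.mem_add (MI.mem_add h1 h2) (MI.mem_ofInt S 0)) ?_
    unfold uC2Real
    simp only [if_neg hii]
    push_cast
    field_simp

end TwistedEncl

end Summit.Ventures.WeilGRH
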